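import Summits.ResolutionOfSingularities.ResolutionOfSingularities.Theorems.FrobeniusClosingSteerToricUnitExitPerron
import HarnessLib

/-!
# Crux `Steer` (stmt-ResolutionOfSingularities-16345) — K-TX, part 2c: monomialisation of finitely many Laurent monomials of positive value and
# ODD-SUPPORT REDUCTION, by local blowings up decided by the valuation

OURS (campaign res-hironaka, rung L ★L-G4, slot W4.1; res-D-brk-2 g6 on res-L0-w41-plan-1 RULING 257 (a)(2), retype 258 (c)). Candidates,
not facts; NOT a statement of H. Hironaka's manuscript [claim: Hironaka2017, status: under-review]; AI formalisation, weaker than expert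
review; `--supports stmt-ResolutionOfSingularities-16345`, counted 0.

## What is proved

`KRel O R z R' z' T` (`§1`): `R'` is a local blowing up of `R` w.r.t. `O` (`IsLocalBlowup`), `(R', z')` is a K-TX frame (part 1), and the
exponent transformer `T` re-expresses every Laurent monomial (`z' ^ (T f) = z ^ f`), commutes with negation, preserves `ℕ`-vectors and odd
coordinates. It is reflexive on frames, transitive (`IsLocalBlowup.trans`), and ONE pair step in the orientation the valuation dictates
produces it (part 1b `frame_step`). The exponent game of `…SteerToricVertexPerron` (its private bookkeeping is repeated in `§2`) then
gives, with the SAME induction texts: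
* `exists_krel_uniform` / `exists_krel_nonneg` / `exists_krel_nonneg_family` (`§3`) — Perron monomialisation of finitely many Laurent
  monomials of positive value, now through regular local stages reached by local blowings up;
* `exists_krel_single_odd` (`§4`) — reduction of the odd support of an `ℕ`-vector to one letter.
[cite: Teissier2014] [cite: NovacoskiSpivakovsky2014, Def. 2.11] [cite: DeJong1996, 2.4] [folklore]
-/

noncomputable section

-- single-problem summit: the doubled namespace component `ResolutionOfSingularities` is forced
set_option linter.dupNamespace false

open scoped BigOperators

namespace Summit.ResolutionOfSingularities.ResolutionOfSingularities.Theorems.SteerToricUnitExit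

open IsLocalRing
open Literature.AlgebraicGeometry.Resolution
open Summit.ResolutionOfSingularities.ResolutionOfSingularities.Theorems.SteerToricVertexSplit

variable {K : Type} [Field K]

section Perron2

variable {n : ℕ}

/-- **Perron monomialisation of a Laurent monomial of positive value**: if `z ^ e ∈ 𝔪_O` (value `< 1`), then after an admissible
re-lettering it is an `ℕ`-monomial in the new letters. OURS. [folklore] -/
theorem exists_krel_nonneg (O : ValuationSubring K) (R : Subring K) (z : Fin n → K) (hF : Frame O R z)
    (e : Fin n → ℤ) (he : O.valuation (∏ j, z j ^ e j) < 1) :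
    ∃ (R' : Subring K) (z' : Fin n → K) (T : (Fin n → ℤ) → (Fin n → ℤ)), KRel O R z R' z' T ∧
      (∀ j, 0 ≤ T e j) := by
  obtain ⟨R', z', T, hR, hU⟩ := exists_krel_uniform O R z hF e
  refine ⟨R', z', T, hR, ?_⟩
  rcases hU with hU | hU
  · exact hU
  · -- all exponents `≤ 0`: then `(z^e)⁻¹ = z' ^ (-T e)` lies in `O`, contradicting `v(z^e) < 1`
    exfalso
    have hinv : (∏ j, z j ^ e j)⁻¹ ∈ O := by
      rw [← hR.2.2.1 e, ← Finset.prod_inv_distrib]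
      refine prod_mem fun j _ => ?_
      rw [← zpow_neg]
      obtain ⟨c, hc⟩ := Int.exists_eq_neg_ofNat (hU j)
      rw [hc, neg_neg, zpow_natCast]
      exact pow_mem (hR.2.1.mem_O j) c
    have hne : (∏ j, z j ^ e j) ≠ 0 := Finset.prod_ne_zero_iff.mpr fun j _ => zpow_ne_zero _ (hF.ne_zero j)
    have h1 : O.valuation ((∏ j, z j ^ e j)⁻¹) ≤ 1 := (O.valuation_le_one_iff _).mpr hinv
    rw [map_inv₀, inv_le_one₀ (zero_lt_iff.mpr ((map_ne_zero _).mpr hne))] at h1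
    exact absurd he (not_lt.mpr h1)

/-- **Perron monomialisation of finitely many Laurent monomials of positive value at once.** OURS. [folklore] -/
theorem exists_krel_nonneg_family (O : ValuationSubring K) :
    ∀ (m : ℕ) (R : Subring K) (z : Fin n → K) (_ : Frame O R z) (F : Fin m → Fin n → ℤ)
      (_ : ∀ i, O.valuation (∏ j, z j ^ F i j) < 1),
      ∃ (R' : Subring K) (z' : Fin n → K) (T : (Fin n → ℤ) → (Fin n → ℤ)), KRel O R z R' z' T ∧
        ∀ i j, 0 ≤ T (F i) j := by
  intro m
  induction m with
  | zero =>
    intro R z hFr F _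
    exact ⟨R, z, id, krel_refl O R z hFr, fun i => i.elim0⟩
  | succ m ih =>
    intro R z hFr F hF
    -- first monomialise `F 0`
    obtain ⟨R₁, z₁, T₁, hR₁, h0⟩ := exists_krel_nonneg O R z hFr (F 0) (hF 0)
    -- the remaining targets, re-expressed in `z₁`
    have hF' : ∀ i : Fin m, O.valuation (∏ j, z₁ j ^ T₁ (F i.succ) j) < 1 := fun i => by
      rw [hR₁.2.2.1]; exact hF i.succ
    obtain ⟨R₂, z₂, T₂, hR₂, hrest⟩ := ih R₁ z₁ hR₁.2.1 (fun i => T₁ (F i.succ)) hF'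
    refine ⟨R₂, z₂, T₂ ∘ T₁, krel_trans O hR₁ hR₂, fun i => ?_⟩
    refine Fin.cases ?_ (fun i => ?_) i
    · exact hR₂.2.2.2.2.1 _ h0
    · exact hrest i

end Perron2


/-! ## §4 Odd-support reduction with the K-TX frame -/

section OddSupport

variable {n : ℕ}

/-- A pair blow-up with both pivot letters odd lowers the number of odd letters by one. [folklore] -/
private theorem card_odd_update_lt (p : Fin n → ℤ) {a b : Fin n} (hab : a ≠ b) (ha : Odd (p a)) (hb : Odd (p b)) :
    (Finset.univ.filter fun j => Odd (Function.update p a (p a + p b) j)).card <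
      (Finset.univ.filter fun j => Odd (p j)).card := by
  classical
  have hsub : (Finset.univ.filter fun j => Odd (Function.update p a (p a + p b) j)) ⊆
      (Finset.univ.filter fun j => Odd (p j)).erase a := by
    intro j hj
    simp only [Finset.mem_filter, Finset.mem_univ, true_and] at hj
    have hja : j ≠ a := by
      rintro rfl
      rw [Function.update_self] at hj
      exact (Int.not_odd_iff_even.mpr (ha.add_odd hb)) hj
    rw [Function.update_of_ne hja] at hj
    simp [hja, hj]
  calc _ ≤ ((Finset.univ.filter fun j => Odd (p j)).erase a).card := Finset.card_le_card hsub
    _ < _ := Finset.card_erase_lt_of_mem (by simp [ha])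

/-- **Odd-support reduction**: a vector with some odd coordinate becomes, after an admissible re-lettering along `O`, a vector with
exactly one odd coordinate. OURS. [folklore] -/
theorem exists_krel_single_odd (O : ValuationSubring K) :
    ∀ (s : ℕ) (R : Subring K) (z : Fin n → K) (_ : Frame O R z) (p : Fin n → ℤ)
      (_ : (Finset.univ.filter fun j => Odd (p j)).card ≤ s) (_ : ∃ j, Odd (p j)),
      ∃ (R' : Subring K) (z' : Fin n → K) (T : (Fin n → ℤ) → (Fin n → ℤ)), KRel O R z R' z' T ∧
        ∃ a, Odd (T p a) ∧ ∀ j, j ≠ a → Even (T p j) := by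
  classical
  intro s
  induction s with
  | zero =>
    intro R z hF p hs hodd
    obtain ⟨j, hj⟩ := hodd
    have : j ∈ (Finset.univ.filter fun j => Odd (p j)) := by simp [hj]
    exact absurd hs (not_le.mpr (Finset.card_pos.mpr ⟨j, this⟩))
  | succ s ih =>
    intro R z hF p hs hodd
    obtain ⟨a, ha⟩ := hodd
    by_cases hone : ∀ j, j ≠ a → Even (p j)
    · exact ⟨R, z, id, krel_refl O R z hF, a, ha, hone⟩
    push Not at hone
    obtain ⟨b, hba, hb⟩ := hone
    rw [Int.not_even_iff_odd] at hb
    -- blow up the pair (a, b) of odd letters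
    rcases krel_step O R z hF hba.symm with ⟨R₁, z₁, hR₁⟩ | ⟨R₁, z₁, hR₁⟩
    · -- pivot `a`
      have hlt := card_odd_update_lt p hba.symm ha hb
      have hodd₁ : ∃ j, Odd (Function.update p a (p a + p b) j) := ⟨b, by rw [Function.update_of_ne hba]; exact hb⟩
      obtain ⟨R₂, z₂, T₂, hR₂, a', ha', hrest⟩ :=
        ih R₁ z₁ hR₁.2.1 _ (Nat.lt_succ_iff.mp (lt_of_lt_of_le hlt hs)) hodd₁
      exact ⟨R₂, z₂, _, krel_trans O hR₁ hR₂, a', ha', hrest⟩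
    · -- pivot `b`
      have hlt := card_odd_update_lt p hba hb ha
      have hodd₁ : ∃ j, Odd (Function.update p b (p b + p a) j) := ⟨a, by rw [Function.update_of_ne hba.symm]; exact ha⟩
      obtain ⟨R₂, z₂, T₂, hR₂, a', ha', hrest⟩ :=
        ih R₁ z₁ hR₁.2.1 _ (Nat.lt_succ_iff.mp (lt_of_lt_of_le hlt hs)) hodd₁
      exact ⟨R₂, z₂, _, krel_trans O hR₁ hR₂, a', ha', hrest⟩

end OddSupport

end Summit.ResolutionOfSingularities.ResolutionOfSingularities.Theorems.SteerToricUnitExit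

end
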